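import Literature.Claims.NS.Lietz2026
import HarnessLib

/-!
# C167 `Lietz2026` — TRUE column: Thm 15.1 (Step 13) holds in the kernel
(ns-claims-typist-4 g6, 2-READ seat; records-grade, D-0026; filed by a salvage seat per ADJUDICATED #154)

Kernel discharge of the CONSUMED binder `Literature.Claims.NS.Lietz2026.Step_T151` of the claim skeleton
`Literature/Claims/NS/Lietz2026.lean` (p543717, tree 44bc56a4a5a94473, l.379): Thm 15.1 (136)–(137) p.22 as
typed — a uniform dyadic decay constant `Ω_k(t) ≤ C·2^{−β_ξ k}` for the sharp vorticity blocks on `[0, T)`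
gives a uniform pointwise vorticity bound. Proof = the print's (138)–(139) route at the sharp-block grain:
Fourier inversion `|ω(x)| ≤ Σ_n ‖ω̂(n)‖` (tree `Torus.norm_le_tsum_norm_mFourierCoeff`), every `n ≠ 0` lies in
the block `k = log₄(2|n|² − 1)`, block Cauchy–Schwarz with `#dyShell k ≤ 2^{3k+9}` (Bernstein), `β_ξ = 6 log₂ φ > 3`
(`three_lt_betaXi`) and the geometric series; the zero mode of a curl vanishes, so the print's separate low
block (140) is not needed.

Effect on the skeleton's compositions: `Lietz2026.claim_of_steps h141 step_T151_holds : ClaimedTheorem` and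
`Lietz2026.claim_of_steps_uniform h133 step_T151_holds : ClaimedTheorem` — the only undischarged consumed
binders are `Step_P141` (135) resp. the head of #154 `Step_T133_uniform` ((129)+(135), FL). Records-grade: no
head / class / locator of #154 is touched. Sibling TRUE twin: `SoloSalvageLietz2026.lean` (`step_L62b_holds`,
salvage-p4 g4). WHAT THIS IS NOT: not a claim about NS regularity or blow-up; not a claim about any author
beyond the typed locator.
-/

open Set MeasureTheory

-- `Summit.NavierStokesRegularity.NavierStokesRegularity.…` is the tree's fixed path (summit = sub-problem).
set_option linter.dupNamespace false

namespace Summit.NavierStokesRegularity.NavierStokesRegularity.Theorems.Lietz2026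

open Literature.Analysis Literature.Analysis.FluidPDE Literature.Analysis.FunctionSpaces
open Literature.Claims.NS.Higgins2026 (T3 E3 C3 Z3 coeff)
open Literature.Claims.NS.Lietz2026

noncomputable section

/-- The file's `phi` is Mathlib's golden ratio. [folklore] -/
private theorem phi_eq_goldenRatio : phi = Real.goldenRatio := rfl

/-! ## Vorticity vocabulary for Thm 15.1 -/

/-- Components of `vort`. [folklore] -/
private theorem vort_apply_zero (v : T3 → E3) (x : T3) :
    vort v x 0 = Torus.partialDeriv 1 v x 2 - Torus.partialDeriv 2 v x 1 := by
  simp [vort]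

/-- Components of `vort`. [folklore] -/
private theorem vort_apply_one (v : T3 → E3) (x : T3) :
    vort v x 1 = Torus.partialDeriv 2 v x 0 - Torus.partialDeriv 0 v x 2 := by
  simp [vort]

/-- Components of `vort`. [folklore] -/
private theorem vort_apply_two (v : T3 → E3) (x : T3) :
    vort v x 2 = Torus.partialDeriv 0 v x 1 - Torus.partialDeriv 1 v x 0 := by
  simp [vort]

/-- The vorticity of a smooth field is smooth. [folklore] -/
private theorem isSmooth_vort {v : T3 → E3} (hv : Torus.IsSmooth v) : Torus.IsSmooth (vort v) := by
  have hc : ∀ i j : Fin 3, Torus.IsSmooth fun x => Torus.partialDeriv i v x j :=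
    fun i j => (hv.partialDeriv i).apply j
  have h0 : Torus.IsSmooth fun x => vort v x 0 := by
    simp_rw [vort_apply_zero]; exact (hc 1 2).sub (hc 2 1)
  have h1 : Torus.IsSmooth fun x => vort v x 1 := by
    simp_rw [vort_apply_one]; exact (hc 2 0).sub (hc 0 2)
  have h2 : Torus.IsSmooth fun x => vort v x 2 := by
    simp_rw [vort_apply_two]; exact (hc 0 1).sub (hc 1 0)
  show ContDiff ℝ _ (Torus.lift (vort v))
  refine (contDiff_piLp (p := 2)).2 fun i => ?_
  fin_cases i
  · exact h0
  · exact h1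
  · exact h2

/-- `|ω(x)|² = ‖vort v x‖²` (the tree's orientation-free `torusVorticitySqAt` is the squared norm of
the curl in dimension three). [folklore] -/
private theorem torusVorticitySqAt_eq_norm_vort_sq (v : T3 → E3) (x : T3) :
    torusVorticitySqAt v x = ‖vort v x‖ ^ 2 := by
  rw [EuclideanSpace.norm_eq, Real.sq_sqrt (Finset.sum_nonneg fun _ _ => sq_nonneg _)]
  simp only [torusVorticitySqAt, Fin.sum_univ_three, Real.norm_eq_abs, sq_abs, vort_apply_zero,
    vort_apply_one, vort_apply_two]
  ring

/-- The vorticity of a smooth periodic field has zero mean. [folklore] -/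
private theorem hasZeroMean_vort {v : T3 → E3} (hv : Torus.IsSmooth v) : Torus.HasZeroMean (vort v) := by
  have hw : Torus.IsSmooth (vort v) := isSmooth_vort hv
  have hint : ∀ j k : Fin 3, ∫ y, Torus.partialDeriv j v y k = 0 := fun j k => by
    have h := Torus.integral_partialDeriv_eq_zero_holds (hv.apply k) j
    simp_rw [Torus.partialDeriv_apply_coord (hv.isContDiff (by simp))] at h
    exact h
  have hI : ∀ j k : Fin 3, Integrable (fun y => Torus.partialDeriv j v y k) volume := fun j k =>
    ((hv.partialDeriv j).apply k).integrable
  have hIc : ∀ i : Fin 3, Integrable (fun y => vort v y i) volume := fun i => (hw.apply i).integrable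
  show ∫ x, vort v x = 0
  ext i
  rw [MeasureTheory.eval_integral_piLp hIc, PiLp.zero_apply]
  fin_cases i
  · show ∫ y, vort v y 0 = 0
    simp_rw [vort_apply_zero]; rw [integral_sub (hI 1 2) (hI 2 1), hint, hint, sub_zero]
  · show ∫ y, vort v y 1 = 0
    simp_rw [vort_apply_one]; rw [integral_sub (hI 2 0) (hI 0 2), hint, hint, sub_zero]
  · show ∫ y, vort v y 2 = 0
    simp_rw [vort_apply_two]; rw [integral_sub (hI 0 1) (hI 1 0), hint, hint, sub_zero]

/-- The zero Fourier mode of the vorticity vanishes. [folklore] -/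
private theorem coeff_vort_zero {v : T3 → E3} (hv : Torus.IsSmooth v) : coeff (vort v) 0 = 0 :=
  Torus.mFourierCoeff_complexify_zero_of_hasZeroMean (isSmooth_vort hv).integrable (hasZeroMean_vort hv)

/-- Pointwise `‖ω(x)‖ ≤ Σ_n ‖ω̂(n)‖` for smooth fields (Fourier inversion). [folklore] -/
private theorem norm_vort_le_tsum {v : T3 → E3} (hv : Torus.IsSmooth v) (x : T3) :
    ‖vort v x‖ ≤ ∑' n : Z3, ‖coeff (vort v) n‖ :=
  Torus.norm_le_tsum_norm_mFourierCoeff (isSmooth_vort hv) x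

/-- The Fourier coefficients of the vorticity of a smooth field are absolutely summable. [folklore] -/
private theorem summable_norm_coeff_vort {v : T3 → E3} (hv : Torus.IsSmooth v) :
    Summable fun n : Z3 => ‖coeff (vort v) n‖ :=
  Torus.summable_norm_mFourierCoeff_of_isSmooth (isSmooth_vort hv)

/-! ## Sharp blocks: membership, cardinality, Cauchy–Schwarz -/

/-- `|n|²` is the cast of the integer sum of squares `Σᵢ |nᵢ|²`. [folklore] -/
private theorem cast_sum_natAbs_sq (n : Z3) :
    ((∑ i, (n i).natAbs ^ 2 : ℕ) : ℝ) = Torus.freqNormSq n := by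
  simp only [Torus.freqNormSq, Nat.cast_sum, Nat.cast_pow, Nat.cast_natAbs, Int.cast_abs, sq_abs]

/-- A nonzero wave vector has positive integer length. [folklore] -/
private theorem sum_natAbs_sq_pos {n : Z3} (hn : n ≠ 0) : 0 < ∑ i, (n i).natAbs ^ 2 := by
  obtain ⟨i, hi⟩ : ∃ i, n i ≠ 0 := by
    by_contra h
    exact hn (funext fun i => not_not.1 fun hi => h ⟨i, hi⟩)
  have : 0 < (n i).natAbs ^ 2 := pow_pos (Int.natAbs_pos.2 hi) 2
  exact lt_of_lt_of_le this
    (Finset.single_le_sum (f := fun j => (n j).natAbs ^ 2) (fun _ _ => Nat.zero_le _) (Finset.mem_univ i))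

/-- One coordinate squared is at most the integer length. [folklore] -/
private theorem sq_le_sum_natAbs_sq (n : Z3) (i : Fin 3) :
    (n i) ^ 2 ≤ ((∑ j, (n j).natAbs ^ 2 : ℕ) : ℤ) := by
  have : ((n i).natAbs ^ 2 : ℕ) ≤ ∑ j, (n j).natAbs ^ 2 :=
    Finset.single_le_sum (f := fun j => (n j).natAbs ^ 2) (fun _ _ => Nat.zero_le _) (Finset.mem_univ i)
  calc (n i) ^ 2 = (((n i).natAbs ^ 2 : ℕ) : ℤ) := by push_cast; exact (sq_abs (n i)).symm
    _ ≤ _ := by exact_mod_cast this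

/-- **Every nonzero wave vector lies in a sharp block**: with `M = |n|²` and `k = log₄(2M − 1)` one has
`4^k < 2M ≤ 4^{k+1}`, i.e. `n ∈ dyShell k`. [cite: Lietz2026, §3 p.4 l.48–92] -/
private theorem mem_dyShell_log {n : Z3} (hn : n ≠ 0) :
    n ∈ dyShell (Nat.log 4 (2 * (∑ i, (n i).natAbs ^ 2) - 1)) := by
  set M := ∑ i, (n i).natAbs ^ 2 with hM
  set k := Nat.log 4 (2 * M - 1) with hk
  have hMpos : 0 < M := sum_natAbs_sq_pos hn
  have hx : 2 * M - 1 ≠ 0 := by omega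
  have h1 : 4 ^ k ≤ 2 * M - 1 := Nat.pow_log_le_self 4 hx
  have h2 : 2 * M - 1 < 4 ^ (k + 1) := Nat.lt_pow_succ_log_self (by norm_num) _
  have h1' : 4 ^ k < 2 * M := by omega
  have h2' : M ≤ 2 * 4 ^ k := by
    have : 4 ^ (k + 1) = 4 * 4 ^ k := by ring
    omega
  have hfour : (4 : ℝ) ^ k = (2 : ℝ) ^ (2 * k) := by rw [pow_mul]; norm_num
  have hMR : (M : ℝ) = Torus.freqNormSq n := cast_sum_natAbs_sq n
  refine Finset.mem_filter.2 ⟨?_, ?_, ?_⟩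
  · refine Fintype.mem_piFinset.2 fun i => Finset.mem_Icc.2 ?_
    have hsq : (n i) ^ 2 ≤ ((2 : ℤ) ^ (k + 1)) ^ 2 := by
      calc (n i) ^ 2 ≤ (M : ℤ) := sq_le_sum_natAbs_sq n i
        _ ≤ 2 * 4 ^ k := by exact_mod_cast h2'
        _ ≤ ((2 : ℤ) ^ (k + 1)) ^ 2 := by
          have h4 : (4 : ℤ) ^ k = (2 ^ k) ^ 2 := by rw [← pow_mul, mul_comm, pow_mul]; norm_num
          have h5 : ((2 : ℤ) ^ (k + 1)) ^ 2 = 4 * (2 ^ k) ^ 2 := by ring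
          rw [h4, h5]
          have : (0 : ℤ) ≤ (2 ^ k) ^ 2 := sq_nonneg _
          linarith
    exact abs_le_of_sq_le_sq' hsq (pow_nonneg (by norm_num) _)
  · rw [← hfour, ← hMR]; exact_mod_cast h1'
  · rw [← hfour, ← hMR]; exact_mod_cast h2'

/-- Cardinality of a sharp block: `#dyShell k ≤ (2^{k+2} + 1)³ ≤ 2^{3k+9}`. [folklore] -/
private theorem card_dyShell_le (k : ℕ) : ((dyShell k).card : ℝ) ≤ (2 : ℝ) ^ (3 * k + 9) := by
  have h1 : (dyShell k).card ≤ (2 ^ (k + 2) + 1) ^ 3 := by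
    calc (dyShell k).card
        ≤ (Fintype.piFinset fun _ : Fin 3 => Finset.Icc (-(2 ^ (k + 1) : ℤ)) (2 ^ (k + 1))).card :=
          Finset.card_filter_le _ _
      _ = ∏ _i : Fin 3, (Finset.Icc (-(2 ^ (k + 1) : ℤ)) (2 ^ (k + 1))).card := Fintype.card_piFinset _
      _ = (2 ^ (k + 2) + 1) ^ 3 := by
          rw [Finset.prod_const, Finset.card_univ, Fintype.card_fin, Int.card_Icc]
          congr 1
          have : (2 : ℤ) ^ (k + 1) + 1 - -2 ^ (k + 1) = ((2 ^ (k + 2) + 1 : ℕ) : ℤ) := by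
            push_cast; ring
          rw [this, Int.toNat_natCast]
  have h2 : ((2 ^ (k + 2) + 1) ^ 3 : ℕ) ≤ 2 ^ (3 * k + 9) := by
    have : 2 ^ (k + 2) + 1 ≤ 2 ^ (k + 3) := by
      have : 1 ≤ 2 ^ (k + 2) := Nat.one_le_two_pow
      calc 2 ^ (k + 2) + 1 ≤ 2 ^ (k + 2) + 2 ^ (k + 2) := by omega
        _ = 2 ^ (k + 3) := by ring
    calc (2 ^ (k + 2) + 1) ^ 3 ≤ (2 ^ (k + 3)) ^ 3 := Nat.pow_le_pow_left this 3
      _ = 2 ^ (3 * k + 9) := by rw [← pow_mul]; ring_nf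
  exact_mod_cast h1.trans h2

/-- Block Cauchy–Schwarz: `Σ_{n ∈ dyShell k} ‖ω̂(n)‖ ≤ √(#dyShell k · Ω_k)`. [folklore] -/
private theorem sum_norm_coeff_le_sqrt (k : ℕ) (v : T3 → E3) :
    ∑ n ∈ dyShell k, ‖coeff (vort v) n‖ ≤ Real.sqrt ((dyShell k).card * Om k v) := by
  refine Real.le_sqrt_of_sq_le ?_
  exact sq_sum_le_card_mul_sum_sq


/-! ## The exponent `β_ξ > 3`, the block ratio, and Thm 15.1 (Step 13) -/

/-- **`β_ξ = 6 log₂ φ > 3`** (since `φ² = φ + 1 > 2`). [cite: Lietz2026, Thm 7.1 (34) p.7 l.37–52] -/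
theorem three_lt_betaXi : 3 < Literature.Claims.NS.Lietz2026.betaXi := by
  have hφ1 : 1 < phi := by rw [phi_eq_goldenRatio]; exact Real.one_lt_goldenRatio
  have hφ0 : 0 < phi := lt_trans one_pos hφ1
  have hsq : Real.sqrt 2 < phi := by
    rw [Real.sqrt_lt' hφ0, phi_eq_goldenRatio, Real.goldenRatio_sq]
    rw [phi_eq_goldenRatio] at hφ1
    linarith
  have hlog : (1 / 2 : ℝ) < Real.logb 2 phi := by
    rw [Real.lt_logb_iff_rpow_lt one_lt_two hφ0, ← Real.sqrt_eq_rpow]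
    exact hsq
  unfold betaXi
  linarith

/-- The per-block ratio `r = 2^{(3−β_ξ)/2} ∈ (0, 1)`. [folklore] -/
private theorem ratio_lt_one : (2 : ℝ) ^ ((3 - betaXi) / 2) < 1 :=
  Real.rpow_lt_one_of_one_lt_of_neg one_lt_two (by linarith [three_lt_betaXi])

/-- The dyadic algebra `2^{3k+9} · 2^{−β_ξ k} = 2⁹ · (r^k)²`. [folklore] -/
private theorem two_pow_mul_decay_eq (k : ℕ) :
    (2 : ℝ) ^ (3 * k + 9) * (2 : ℝ) ^ (-(betaXi * k)) =
      2 ^ 9 * (((2 : ℝ) ^ ((3 - betaXi) / 2)) ^ k) ^ 2 := by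
  have h2 : (0 : ℝ) ≤ 2 := by norm_num
  rw [← Real.rpow_natCast ((2 : ℝ) ^ ((3 - betaXi) / 2)) k, ← Real.rpow_mul h2,
    ← Real.rpow_natCast (2 ^ ((3 - betaXi) / 2 * (k : ℝ))) 2, ← Real.rpow_mul h2,
    show (2 : ℝ) ^ (3 * k + 9) = 2 ^ 9 * (2 : ℝ) ^ ((3 * k : ℕ) : ℝ) by rw [Real.rpow_natCast]; ring,
    mul_assoc, ← Real.rpow_add two_pos]
  congr 1
  congr 1
  push_cast
  ring

/-- **Step 13 HOLDS (kernel)** — Thm 15.1 (136)–(137) as typed: a uniform dyadic decay constant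
`Ω_k(t) ≤ C 2^{−β_ξ k}` on `[0, T)` gives `|ω(t, x)| ≤ B` uniformly, by Fourier inversion
`|ω(x)| ≤ Σ_n |ω̂(n)|`, block Cauchy–Schwarz `Σ_{dyShell k} |ω̂| ≤ (#dyShell k · Ω_k)^{1/2} ≤ 2^{9/2}√C · 2^{(3−β_ξ)k/2}`
(Bernstein on the sharp block, (138)–(139)) and the geometric series (`β_ξ > 3`); the zero mode of a
curl vanishes (the print's low block (140) is not needed at this grain: every `n ≠ 0` lies in some block).
[cite: Lietz2026, Thm 15.1 (136)–(140) p.22 l.3–34] -/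
theorem step_T151_holds : Literature.Claims.NS.Lietz2026.Step_T151 := by
  intro ν hν T hT u p hcl hdec
  obtain ⟨C, hC⟩ := hdec
  set r : ℝ := (2 : ℝ) ^ ((3 - betaXi) / 2) with hr
  have hr0 : 0 < r := Real.rpow_pos_of_pos two_pos _
  have hr1 : r < 1 := ratio_lt_one
  have hC0 : 0 ≤ C := by
    have h := hC 0 0 ⟨le_rfl, hT⟩
    have h0 : 0 ≤ Om 0 (u 0) := Finset.sum_nonneg fun _ _ => sq_nonneg _
    simp only [CharP.cast_eq_zero, mul_zero, neg_zero, Real.rpow_zero, mul_one] at h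
    linarith
  set A : ℝ := Real.sqrt (2 ^ 9 * C) with hA
  have hA0 : 0 ≤ A := Real.sqrt_nonneg _
  refine ⟨A / (1 - r), fun t ht x => ?_⟩
  have hsm : Torus.IsSmooth (u t) := hcl.smooth_velocity.isSmooth_slice ht
  -- one block
  have hblock : ∀ k : ℕ, ∑ n ∈ dyShell k, ‖coeff (vort (u t)) n‖ ≤ A * r ^ k := by
    intro k
    refine (sum_norm_coeff_le_sqrt k (u t)).trans ?_
    have hOm0 : 0 ≤ Om k (u t) := Finset.sum_nonneg fun _ _ => sq_nonneg _
    calc Real.sqrt ((dyShell k).card * Om k (u t))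
        ≤ Real.sqrt ((2 : ℝ) ^ (3 * k + 9) * (C * (2 : ℝ) ^ (-(betaXi * k)))) :=
          Real.sqrt_le_sqrt (mul_le_mul (card_dyShell_le k) (hC k t ht) hOm0 (by positivity))
      _ = Real.sqrt ((2 ^ 9 * C) * (r ^ k) ^ 2) := by
          congr 1
          have h := two_pow_mul_decay_eq k
          calc (2 : ℝ) ^ (3 * k + 9) * (C * (2 : ℝ) ^ (-(betaXi * k)))
              = C * ((2 : ℝ) ^ (3 * k + 9) * (2 : ℝ) ^ (-(betaXi * k))) := by ring
            _ = C * (2 ^ 9 * (r ^ k) ^ 2) := by rw [h]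
            _ = (2 ^ 9 * C) * (r ^ k) ^ 2 := by ring
      _ = A * r ^ k := by
          rw [Real.sqrt_mul (by positivity), Real.sqrt_sq (pow_nonneg hr0.le k)]
  -- finite partial sums
  have hpartial : ∀ S : Finset Z3, ∑ n ∈ S, ‖coeff (vort (u t)) n‖ ≤ A / (1 - r) := by
    intro S
    have hz : ‖coeff (vort (u t)) 0‖ = 0 := by rw [coeff_vort_zero hsm, norm_zero]
    rw [← Finset.sum_erase S hz]
    set S' := S.erase 0 with hS'
    -- the block index `k(n) = log₄(2|n|² − 1)` as the fibre map
    set idx : Z3 → ℕ := fun n => Nat.log 4 (2 * (∑ i, (n i).natAbs ^ 2) - 1) with hidx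
    have hmaps : ∀ n ∈ S', idx n ∈ S'.image idx := fun n hn => Finset.mem_image_of_mem _ hn
    rw [← Finset.sum_fiberwise_of_maps_to hmaps]
    have hgeo : Summable fun k : ℕ => A * r ^ k := (summable_geometric_of_lt_one hr0.le hr1).mul_left A
    calc ∑ k ∈ S'.image idx, ∑ n ∈ S' with idx n = k, ‖coeff (vort (u t)) n‖
        ≤ ∑ k ∈ S'.image idx, A * r ^ k := by
          refine Finset.sum_le_sum fun k _ => ?_
          refine le_trans (Finset.sum_le_sum_of_subset_of_nonneg ?_ fun _ _ _ => norm_nonneg _) (hblock k)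
          intro n hn
          rw [Finset.mem_filter] at hn
          rw [← hn.2]
          exact mem_dyShell_log (Finset.ne_of_mem_erase hn.1)
      _ ≤ ∑' k : ℕ, A * r ^ k :=
          hgeo.sum_le_tsum (S'.image idx) fun k _ => mul_nonneg hA0 (pow_nonneg hr0.le k)
      _ = A / (1 - r) := by
          rw [tsum_mul_left, tsum_geometric_of_lt_one hr0.le hr1, div_eq_mul_inv]
  have htsum : ∑' n : Z3, ‖coeff (vort (u t)) n‖ ≤ A / (1 - r) :=
    (summable_norm_coeff_vort hsm).tsum_le_of_sum_le hpartial
  have hnorm : ‖vort (u t) x‖ ≤ A / (1 - r) := (norm_vort_le_tsum hsm x).trans htsum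
  rw [torusVorticitySqAt_eq_norm_vort_sq]
  exact pow_le_pow_left₀ (norm_nonneg _) hnorm 2

end

end Summit.NavierStokesRegularity.NavierStokesRegularity.Theorems.Lietz2026
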